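import Mathlib
import Literature.Barriers.NavierStokesRegularity.DyadicCascadePositivity
import HarnessLib

/-!
# The viscous dyadic model: uniqueness of weak solutions for non-negative data
  (Barbato–Morandin–Romito 2011, Prop. 3.2)

Barrier catalogue `Literature/Barriers/NavierStokesRegularity/`, second **proof file** towards the
named fact `Dyadic.BarbatoMorandinRomito2011_thm1` (`DyadicCascadeRegularity`). We prove the
uniqueness clause of BMR's Theorem 1 in the form printed as the second sentence of Prop. 3.2:
"if `β ≤ 3`, there is a unique weak solution for any positive initial condition in `H`" — for
`ν > 0`, `0 < β ≤ 3`, `λ = 2` and a datum `x` with `xₙ ≥ 0`, `∑xₙ² < ∞`, any two weak solutions of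
(1.1) (BMR Def. 3.1, `IsBMRWeakSolution`) coincide at all modes `n ≥ 1` and times `t ≥ 0`
(`IsBMRWeakSolution.unique`).

## The printed proof and its transcription

With `Z = Y - X`, `W = X + Y` one has
`Żₙ = -νλₙ²Zₙ + λ_{n-1}^βZ_{n-1}W_{n-1} - ½λₙ^β(ZₙW_{n+1} + Z_{n+1}Wₙ)`; for
`ψ_N = ∑_{n≤N} 2^{-n}Zₙ²` the cross terms telescope (the weights `2^{-n}` are chosen for this) and
`ψ_N' + 2ν∑2^{-n}λₙ²Zₙ² = -∑2^{-n}λₙ^βZₙ²W_{n+1} - 2^{-N}λ_N^βZ_NZ_{N+1}W_N`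
(`two_mul_sum_weight_mul_sub_bmrRHS`, an identity between states; the paper prints the last
coefficient as `2^{-(N+1)}`, immaterial). Both solutions are non-negative
(`IsBMRWeakSolution.nonneg`), so `ψ_N' ≤ -2^{-N}λ_N^βZ_NZ_{N+1}W_N ≤ 2^{-N}λ_N^β(X_{N+1}Y_N² + X_N²Y_{N+1})`,
and with `X_{N+1}, Y_{N+1} ≤ (∑xₙ²)^{1/2}` (energy inequality) and `2^{-N}λ_N^β = λ_N^{β-1} ≤ λ_N²`
(`β ≤ 3`): `ψ_N' ≤ c λ_N²(X_N² + Y_N²)`. Hence `ψ_N(t) ≤ c∫₀ᵗλ_N²(X_N² + Y_N²) → 0` as `N → ∞`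
(`IsBMRWeakSolution.tendsto_integral_dissipation`: both are Leray–Hopf), while `ψ_N(t) ≥ 2^{-n}Zₙ(t)²`
for `N ≥ n`; so `Z ≡ 0`. The comparison `ψ_N ≤ c∫…` is Mathlib's
`image_le_of_deriv_right_le_deriv_boundary`. Theorem-only module.

## References

* D. Barbato, F. Morandin, M. Romito, *Smooth solutions for the dyadic model*, Nonlinearity 24
  (2011) 3083–3097, §3 Prop. 3.2 and its proof. [`BarbatoMorandinRomito2011`]
* D. Barbato, F. Flandoli, F. Morandin, C. R. Math. Acad. Sci. Paris 348 (2010) 525–528 (the idea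
  of the weighted `ℓ²` distance, cited as [BarFlaMor09b] in the source).
-/

noncomputable section

open Set Filter MeasureTheory intervalIntegral
open scoped Topology BigOperators

namespace Literature.Barriers.NavierStokesRegularity.Dyadic

/-! ## The weighted difference identity -/

/-- `2 · (1/2)^{m+1} = (1/2)^m`. [folklore] -/
theorem two_mul_half_pow_succ (m : ℕ) : 2 * ((1 : ℝ) / 2) ^ (m + 1) = ((1 : ℝ) / 2) ^ m := by
  rw [pow_succ]; ring

/-- **The identity behind Prop. 3.2.** For states `X, Y : ℕ → ℝ`, `Z = Y - X`, `W = X + Y` and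
`β ≠ 0`:
`2∑_{n=1}^{N} 2^{-n}Zₙ(RHSₙ(Y) - RHSₙ(X)) = -2ν∑_{n=1}^N 2^{-n}λₙ²Zₙ² - ∑_{n=1}^N 2^{-n}λₙ^βZₙ²W_{n+1}
  - 2^{-N}λ_N^βW_NZ_NZ_{N+1}`
("it is elementary to verify that …"; the transport terms telescope thanks to the weights
`2^{-n}`). [cite: BarbatoMorandinRomito2011, §3 Prop. 3.2 (proof)] -/
theorem two_mul_sum_weight_mul_sub_bmrRHS (ν : ℝ) {β : ℝ} (hβ : β ≠ 0) (X Y : ℕ → ℝ) (N : ℕ) :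
    2 * ∑ m ∈ Finset.range N, ((1 : ℝ) / 2) ^ (m + 1) * (Y (m + 1) - X (m + 1)) *
        (bmrRHS ν β Y (m + 1) - bmrRHS ν β X (m + 1)) =
      -2 * ν * ∑ m ∈ Finset.range N,
          ((1 : ℝ) / 2) ^ (m + 1) * bmrLambda (m + 1) ^ 2 * (Y (m + 1) - X (m + 1)) ^ 2 -
        ∑ m ∈ Finset.range N, ((1 : ℝ) / 2) ^ (m + 1) * bmrLambda (m + 1) ^ β *
          (Y (m + 1) - X (m + 1)) ^ 2 * (X (m + 2) + Y (m + 2)) -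
        ((1 : ℝ) / 2) ^ N * bmrLambda N ^ β * (X N + Y N) * (Y N - X N) * (Y (N + 1) - X (N + 1)) := by
  -- the telescoping flux
  set f : ℕ → ℝ := fun m => ((1 : ℝ) / 2) ^ m * bmrLambda m ^ β * (X m + Y m) * (Y m - X m) *
    (Y (m + 1) - X (m + 1)) with hf
  have hterm : ∀ m, 2 * (((1 : ℝ) / 2) ^ (m + 1) * (Y (m + 1) - X (m + 1)) *
      (bmrRHS ν β Y (m + 1) - bmrRHS ν β X (m + 1))) =
      -2 * ν * (((1 : ℝ) / 2) ^ (m + 1) * bmrLambda (m + 1) ^ 2 * (Y (m + 1) - X (m + 1)) ^ 2) -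
        ((1 : ℝ) / 2) ^ (m + 1) * bmrLambda (m + 1) ^ β * (Y (m + 1) - X (m + 1)) ^ 2 *
          (X (m + 2) + Y (m + 2)) + (f m - f (m + 1)) := by
    intro m
    simp only [hf, bmrRHS_succ, pow_succ]
    ring
  rw [Finset.mul_sum]
  simp only [hterm, Finset.sum_add_distrib, Finset.sum_sub_distrib, ← Finset.mul_sum,
    Finset.sum_range_sub' f]
  simp only [hf, pow_zero, bmrLambda_zero_rpow hβ]
  ring

/-- The sign step of Prop. 3.2: for non-negative reals,
`-(X + Y)(Y - X)(Y' - X') ≤ X'Y² + X²Y'`. [cite: BarbatoMorandinRomito2011, §3 Prop. 3.2 (proof)] -/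
theorem neg_flux_le {a b a' b' : ℝ} (ha : 0 ≤ a) (hb : 0 ≤ b) (ha' : 0 ≤ a') (hb' : 0 ≤ b') :
    -((a + b) * (b - a) * (b' - a')) ≤ a' * b ^ 2 + a ^ 2 * b' := by
  nlinarith [mul_nonneg (mul_nonneg hb hb) hb', mul_nonneg (mul_nonneg ha ha) ha']

/-- `2^{-N}λ_N^β ≤ λ_N²` for `β ≤ 3` (`λ_N = 2^N`, i.e. `λ_N^{β-1} ≤ λ_N²`). [cite: BarbatoMorandinRomito2011, §3 Prop. 3.2 (proof)] -/
theorem half_pow_mul_bmrLambda_rpow_le {β : ℝ} (hβ : β ≠ 0) (hβ3 : β ≤ 3) (N : ℕ) :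
    ((1 : ℝ) / 2) ^ N * bmrLambda N ^ β ≤ bmrLambda N ^ 2 := by
  rcases Nat.eq_zero_or_pos N with rfl | hN
  · simp [Real.zero_rpow hβ]
  have hL : bmrLambda N = 2 ^ N := bmrLambda_of_ne_zero (by omega)
  have h1 : (1 : ℝ) ≤ bmrLambda N := one_le_bmrLambda (by omega)
  have hle : bmrLambda N ^ β ≤ bmrLambda N ^ (3 : ℝ) :=
    Real.rpow_le_rpow_of_exponent_le h1 hβ3
  have h3 : bmrLambda N ^ (3 : ℝ) = bmrLambda N ^ (3 : ℕ) := by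
    rw [← Real.rpow_natCast]; norm_num
  rw [h3] at hle
  have hhalf : ((1 : ℝ) / 2) ^ N * bmrLambda N = 1 := by
    rw [hL, ← mul_pow]; norm_num
  calc ((1 : ℝ) / 2) ^ N * bmrLambda N ^ β ≤ ((1 : ℝ) / 2) ^ N * bmrLambda N ^ (3 : ℕ) :=
        mul_le_mul_of_nonneg_left hle (by positivity)
    _ = (((1 : ℝ) / 2) ^ N * bmrLambda N) * bmrLambda N ^ 2 := by ring
    _ = bmrLambda N ^ 2 := by rw [hhalf, one_mul]

/-! ## Uniqueness -/

section Unique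

variable {ν β : ℝ} {x : ℕ → ℝ} {X Y : ℕ → ℝ → ℝ}

/-- **Barbato–Morandin–Romito 2011, Prop. 3.2 (uniqueness for `β ≤ 3`).** "If `β ≤ 3`, there is
a unique weak solution for any positive initial condition in `H`": for `ν > 0`, `0 < β ≤ 3` and a
datum with `xₙ ≥ 0` (`n ≥ 1`), `∑xₙ² < ∞`, two weak solutions of (1.1) (BMR Def. 3.1) agree at
all modes `n ≥ 1` and all times `t ≥ 0`. (The first sentence of Prop. 3.2 — uniqueness given a
positive solution with `sup λₙ^{β-3}Xₙ < ∞` — reduces to this for `β ≤ 3`, where the energy bound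
gives `λₙ^{β-3}Xₙ ≤ ‖x‖_H`.) Proof as printed, see the module docstring.
[cite: BarbatoMorandinRomito2011, §3 Prop. 3.2] -/
theorem IsBMRWeakSolution.unique (hX : IsBMRWeakSolution ν β x X) (hY : IsBMRWeakSolution ν β x Y)
    (hν : 0 < ν) (hβ : 0 < β) (hβ3 : β ≤ 3) (hx : ∀ n, 1 ≤ n → 0 ≤ x n)
    (hx2 : Summable fun n => x n ^ 2) : ∀ n, 1 ≤ n → ∀ t, 0 ≤ t → X n t = Y n t := by
  have hβ0 : β ≠ 0 := hβ.ne'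
  have hXp := hX.nonneg hβ0 hx
  have hYp := hY.nonneg hβ0 hx
  set Mx : ℝ := Real.sqrt (∑' k, x k ^ 2) with hMx
  have hMx0 : 0 ≤ Mx := Real.sqrt_nonneg _
  have hXle : ∀ n, 1 ≤ n → ∀ t, 0 ≤ t → X n t ≤ Mx := fun n hn t ht =>
    hX.le_sqrt_tsum hβ0 hν.le hx hx2 hn ht
  have hYle : ∀ n, 1 ≤ n → ∀ t, 0 ≤ t → Y n t ≤ Mx := fun n hn t ht =>
    hY.le_sqrt_tsum hβ0 hν.le hx hx2 hn ht
  -- continuity of the (clamped) modes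
  have hXc : ∀ n, 1 ≤ n → Continuous fun τ => X n (max τ 0) := fun n hn => hX.continuous_clamp hn
  have hYc : ∀ n, 1 ≤ n → Continuous fun τ => Y n (max τ 0) := fun n hn => hY.continuous_clamp hn
  -- the weighted distance `ψ_N`, `N = M + 1`
  intro n hn t ht
  obtain ⟨j, rfl⟩ : ∃ j, n = j + 1 := ⟨n - 1, by omega⟩
  -- it suffices to show `2^{-(j+1)} Z_{j+1}(t)² ≤ Mx (a_M + b_M)` for all `M ≥ j`
  set a : ℕ → ℝ := fun M => ∫ τ in (0 : ℝ)..t, bmrLambda (M + 1) ^ 2 * X (M + 1) τ ^ 2 with ha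
  set b : ℕ → ℝ := fun M => ∫ τ in (0 : ℝ)..t, bmrLambda (M + 1) ^ 2 * Y (M + 1) τ ^ 2 with hb
  have hab : Tendsto (fun M => Mx * (a M + b M)) atTop (𝓝 0) := by
    have h := ((hX.tendsto_integral_dissipation hβ0 hν hx hx2 ht).add
      (hY.tendsto_integral_dissipation hβ0 hν hx hx2 ht)).const_mul Mx
    rw [add_zero, mul_zero] at h
    exact h
  have key : ∀ M, j ≤ M →
      ((1 : ℝ) / 2) ^ (j + 1) * (Y (j + 1) t - X (j + 1) t) ^ 2 ≤ Mx * (a M + b M) := by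
    intro M hjM
    -- `ψ = ψ_{M+1}` and the comparison function `B`
    set ψ : ℝ → ℝ := fun τ => ∑ m ∈ Finset.range (M + 1),
      ((1 : ℝ) / 2) ^ (m + 1) * (Y (m + 1) τ - X (m + 1) τ) ^ 2 with hψ
    set g : ℝ → ℝ := fun τ => Mx * (bmrLambda (M + 1) ^ 2 * X (M + 1) (max τ 0) ^ 2 +
      bmrLambda (M + 1) ^ 2 * Y (M + 1) (max τ 0) ^ 2) with hg
    have hgc : Continuous g :=
      continuous_const.mul ((continuous_const.mul ((hXc (M + 1) (by omega)).pow 2)).add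
        (continuous_const.mul ((hYc (M + 1) (by omega)).pow 2)))
    set B : ℝ → ℝ := fun τ => ∫ r in (0 : ℝ)..τ, g r with hB
    have hBd : ∀ τ, HasDerivAt B (g τ) τ := fun τ =>
      intervalIntegral.integral_hasDerivAt_right (hgc.intervalIntegrable 0 τ)
        (hgc.stronglyMeasurableAtFilter _ _) hgc.continuousAt
    have hBc : ContinuousOn B (Icc 0 t) := fun τ _ => (hBd τ).continuousAt.continuousWithinAt
    -- derivative of `ψ`
    set ψ' : ℝ → ℝ := fun τ => 2 * ∑ m ∈ Finset.range (M + 1), ((1 : ℝ) / 2) ^ (m + 1) *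
      (Y (m + 1) τ - X (m + 1) τ) *
      (bmrRHS ν β (fun k => Y k τ) (m + 1) - bmrRHS ν β (fun k => X k τ) (m + 1)) with hψ'
    have hψd : ∀ τ, 0 ≤ τ → HasDerivWithinAt ψ (ψ' τ) (Ici 0) τ := by
      intro τ hτ
      have hsum := HasDerivWithinAt.fun_sum (u := Finset.range (M + 1))
        (A := fun m r => ((1 : ℝ) / 2) ^ (m + 1) * (Y (m + 1) r - X (m + 1) r) ^ 2)
        (A' := fun m => ((1 : ℝ) / 2) ^ (m + 1) * (2 * (Y (m + 1) τ - X (m + 1) τ) *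
          (bmrRHS ν β (fun k => Y k τ) (m + 1) - bmrRHS ν β (fun k => X k τ) (m + 1))))
        (x := τ) (s := Ici 0) fun m _ => by
          have h := ((hY.2 (m + 1) (by omega) τ hτ).sub (hX.2 (m + 1) (by omega) τ hτ)).fun_pow 2
          have h' := h.const_mul (((1 : ℝ) / 2) ^ (m + 1))
          simpa using h'
      refine hsum.congr_deriv ?_
      simp only [hψ', Finset.mul_sum]
      exact Finset.sum_congr rfl fun m _ => by ring
    have hψc : ContinuousOn ψ (Icc 0 t) := fun τ hτ =>
      ((hψd τ hτ.1).continuousWithinAt).mono Icc_subset_Ici_self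
    -- the pointwise bound `ψ' ≤ g` on `[0, t)`
    have hbound : ∀ τ ∈ Ico 0 t, ψ' τ ≤ g τ := by
      intro τ hτ
      have hτ0 : 0 ≤ τ := hτ.1
      have hid := two_mul_sum_weight_mul_sub_bmrRHS ν hβ0 (fun k => X k τ) (fun k => Y k τ) (M + 1)
      have hψ'eq : ψ' τ = _ := hid
      rw [hψ'eq]
      simp only [hg, max_eq_left hτ0]
      -- signs of the three pieces
      have h1 : 0 ≤ ∑ m ∈ Finset.range (M + 1),
          ((1 : ℝ) / 2) ^ (m + 1) * bmrLambda (m + 1) ^ 2 * (Y (m + 1) τ - X (m + 1) τ) ^ 2 :=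
        Finset.sum_nonneg fun m _ => by positivity
      have h2 : 0 ≤ ∑ m ∈ Finset.range (M + 1), ((1 : ℝ) / 2) ^ (m + 1) * bmrLambda (m + 1) ^ β *
          (Y (m + 1) τ - X (m + 1) τ) ^ 2 * (X (m + 2) τ + Y (m + 2) τ) :=
        Finset.sum_nonneg fun m _ => mul_nonneg (mul_nonneg (mul_nonneg (by positivity)
          (bmrLambda_rpow_nonneg _ _)) (sq_nonneg _))
          (add_nonneg (hXp (m + 2) (by omega) τ hτ0) (hYp (m + 2) (by omega) τ hτ0))
      have h3 : -(((1 : ℝ) / 2) ^ (M + 1) * bmrLambda (M + 1) ^ β * (X (M + 1) τ + Y (M + 1) τ) *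
          (Y (M + 1) τ - X (M + 1) τ) * (Y (M + 1 + 1) τ - X (M + 1 + 1) τ)) ≤
          Mx * (bmrLambda (M + 1) ^ 2 * X (M + 1) τ ^ 2 + bmrLambda (M + 1) ^ 2 * Y (M + 1) τ ^ 2) := by
        have hw : 0 ≤ ((1 : ℝ) / 2) ^ (M + 1) * bmrLambda (M + 1) ^ β :=
          mul_nonneg (by positivity) (bmrLambda_rpow_nonneg _ _)
        have hflux := neg_flux_le (hXp (M + 1) (by omega) τ hτ0) (hYp (M + 1) (by omega) τ hτ0)
          (hXp (M + 1 + 1) (by omega) τ hτ0) (hYp (M + 1 + 1) (by omega) τ hτ0)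
        have hX2 := hXle (M + 1 + 1) (by omega) τ hτ0
        have hY2 := hYle (M + 1 + 1) (by omega) τ hτ0
        have hwle := half_pow_mul_bmrLambda_rpow_le hβ0 hβ3 (M + 1)
        calc -(((1 : ℝ) / 2) ^ (M + 1) * bmrLambda (M + 1) ^ β * (X (M + 1) τ + Y (M + 1) τ) *
              (Y (M + 1) τ - X (M + 1) τ) * (Y (M + 1 + 1) τ - X (M + 1 + 1) τ))
            = (((1 : ℝ) / 2) ^ (M + 1) * bmrLambda (M + 1) ^ β) *
                -((X (M + 1) τ + Y (M + 1) τ) * (Y (M + 1) τ - X (M + 1) τ) *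
                  (Y (M + 1 + 1) τ - X (M + 1 + 1) τ)) := by ring
          _ ≤ (((1 : ℝ) / 2) ^ (M + 1) * bmrLambda (M + 1) ^ β) *
                (X (M + 1 + 1) τ * Y (M + 1) τ ^ 2 + X (M + 1) τ ^ 2 * Y (M + 1 + 1) τ) :=
              mul_le_mul_of_nonneg_left hflux hw
          _ ≤ (((1 : ℝ) / 2) ^ (M + 1) * bmrLambda (M + 1) ^ β) *
                (Mx * Y (M + 1) τ ^ 2 + X (M + 1) τ ^ 2 * Mx) := by
              gcongr
          _ = Mx * ((((1 : ℝ) / 2) ^ (M + 1) * bmrLambda (M + 1) ^ β) *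
                (X (M + 1) τ ^ 2 + Y (M + 1) τ ^ 2)) := by ring
          _ ≤ Mx * (bmrLambda (M + 1) ^ 2 * (X (M + 1) τ ^ 2 + Y (M + 1) τ ^ 2)) :=
              mul_le_mul_of_nonneg_left (mul_le_mul_of_nonneg_right hwle (by positivity)) hMx0
          _ = Mx * (bmrLambda (M + 1) ^ 2 * X (M + 1) τ ^ 2 +
                bmrLambda (M + 1) ^ 2 * Y (M + 1) τ ^ 2) := by ring
      nlinarith [mul_nonneg hν.le h1]
    -- comparison
    have hcomp := image_le_of_deriv_right_le_deriv_boundary hψc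
      (fun τ hτ => (hψd τ hτ.1).mono (Ici_subset_Ici.2 hτ.1)) (B := B) (B' := g) ?_ hBc
      (fun τ _ => (hBd τ).hasDerivWithinAt) hbound (right_mem_Icc.2 ht)
    · -- unpack: `2^{-(j+1)} Z_{j+1}(t)² ≤ ψ t ≤ B t = Mx (a M + b M)`
      have hjt : ((1 : ℝ) / 2) ^ (j + 1) * (Y (j + 1) t - X (j + 1) t) ^ 2 ≤ ψ t :=
        Finset.single_le_sum (f := fun m => ((1 : ℝ) / 2) ^ (m + 1) * (Y (m + 1) t - X (m + 1) t) ^ 2)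
          (fun m _ => by positivity) (Finset.mem_range.2 (by omega))
      refine hjt.trans (hcomp.trans (le_of_eq ?_))
      have hXi : IntervalIntegrable (fun τ => bmrLambda (M + 1) ^ 2 * X (M + 1) (max τ 0) ^ 2)
          volume 0 t := (continuous_const.mul ((hXc (M + 1) (by omega)).pow 2)).intervalIntegrable _ _
      have hYi : IntervalIntegrable (fun τ => bmrLambda (M + 1) ^ 2 * Y (M + 1) (max τ 0) ^ 2)
          volume 0 t := (continuous_const.mul ((hYc (M + 1) (by omega)).pow 2)).intervalIntegrable _ _
      simp only [hB, hg, ha, hb]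
      rw [intervalIntegral.integral_const_mul, intervalIntegral.integral_add hXi hYi]
      congr 2
      · exact intervalIntegral.integral_congr fun τ hτ => by
          rw [uIcc_of_le ht] at hτ; simp [max_eq_left hτ.1]
      · exact intervalIntegral.integral_congr fun τ hτ => by
          rw [uIcc_of_le ht] at hτ; simp [max_eq_left hτ.1]
    · -- `ψ 0 = 0 = B 0`
      simp only [hψ, hB, intervalIntegral.integral_same]
      refine le_of_eq (Finset.sum_eq_zero fun m _ => ?_)
      rw [hX.1 (m + 1) (by omega), hY.1 (m + 1) (by omega), sub_self]
      ring
  -- conclusion: the constant sequence is squeezed to `0`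
  have hlim : ((1 : ℝ) / 2) ^ (j + 1) * (Y (j + 1) t - X (j + 1) t) ^ 2 ≤ 0 :=
    ge_of_tendsto hab (eventually_atTop.2 ⟨j, fun M hM => key M hM⟩)
  have hpow : (0 : ℝ) < ((1 : ℝ) / 2) ^ (j + 1) := by positivity
  have hsq : (Y (j + 1) t - X (j + 1) t) ^ 2 ≤ 0 :=
    le_of_mul_le_mul_left (a := ((1 : ℝ) / 2) ^ (j + 1)) (by rw [mul_zero]; exact hlim) hpow
  have : Y (j + 1) t - X (j + 1) t = 0 := by
    have h := sq_nonneg (Y (j + 1) t - X (j + 1) t)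
    exact pow_eq_zero_iff (n := 2) (by norm_num) |>.1 (le_antisymm hsq h)
  linarith

end Unique

end Literature.Barriers.NavierStokesRegularity.Dyadic
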